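import Literature.Geometry.Symplectic.HondaUntwistedModel
import Literature.Geometry.Symplectic.BoundaryChartImmersion
import Literature.Geometry.Symplectic.PuncturedDiscClosedOneForm
import Mathlib.LinearAlgebra.FiniteDimensional.Basic
import HarnessLib

/-!
# Toroidal coordinates about the unit circle of `ℝ⁴`

Topic `Literature/Geometry/Symplectic` (groundwork for the named fact
`Literature.Geometry.Symplectic.relNearSymplecticTaubesTubes_exists`, docstring step 4; everything
here is PROVED).

The flat toroidal coordinate map about the circle `C₀ = {y₀² + y₁² = 1, y₂ = y₃ = 0} ⊂ ℝ⁴`,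
`T(y) = (arg(y₀ + iy₁), √(y₀² + y₁²) − 1, y₂, y₃)`, identifies the solid torus
`U_δ = flatSolidTorus δ` (`δ ≤ 1`) with `(ℝ/2πℤ) × B³(δ)`; we work upstairs in
`ℝ_θ × ℝ³ = ℝ⁴` (coordinates `q = (θ, x₁, x₂, x₃)`), where `T` is a section of the covering
`(θ, x) ↦ ((1 + x₁) cos θ, (1 + x₁) sin θ, x₂, x₃)` over the complement of the cut
`{y₁ = 0, y₀ ≤ 0}`, and `T' = (arg(−(y₀ + iy₁)) + π, …)` is the section over the complement of the
opposite cut; the two differ by `2πk · e_θ`, `k ∈ ℤ` (`k ∈ {0, 1}`).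

## Content (all `[folklore]` calculus)

* `toroidalMap`, `toroidalMap'` — the two branches; `toroidalDeriv y` — their common derivative,
  the continuous linear map `u ↦ (dt(u), da(u), u₂, u₃)` with `dt = (y₀dy₁ − y₁dy₀)/r²`,
  `da = dr` (`toroidalDt`, `toroidalDa` of `HondaUntwistedModel`);
* `hasFDerivAt_toroidalMap`, `hasFDerivAt_toroidalMap'`, `contDiffAt_toroidalMap`,
  `contDiffAt_toroidalMap'` — differentiability off the respective cuts;
* `toroidalMap'_eq_toroidalMap_add` — the branch relation `T' = T + 2πk e_θ`;
* `toroidalDeriv_injective` — `dT_y` is invertible off the axis;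
* `eq_of_toroidalMap_eq_add` — `T` is injective modulo `2πℤ e_θ` off the axis (polar
  coordinates);
* `toroidalMap_mem_hondaTube` — `T(U_δ) ⊆ ℝ × B³(δ)`; `exists_toroidalMap_eq_of_mem_hondaAxis` —
  every point of the axis is `T(y) + 2πk e_θ` for some `y ∈ C₀`.

## References

Folklore (polar/toroidal coordinates); the angle branches and `d(arg) = (x dy − y dx)/r²` are the
tree's `Literature.Geometry.Symplectic.hasFDerivAt_arg`, `hasFDerivAt_arg_neg_add_pi`
(`PuncturedDiscClosedOneForm.lean`).  Used for Taubes 1998, §1.c (toroidal coordinates about a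
zero circle) [Taubes1998S1B3].
-/

noncomputable section

open scoped Topology Real ContDiff
open Set Complex Filter

namespace Literature.Geometry.Symplectic

open Literature.Topology.FourManifolds (contDiffAt_arg)
open Literature.Geometry.Symplectic.LegendrianDarboux (euclidean_four_ext)

/-- Local notation for the model space `ℝ⁴ = EuclideanSpace ℝ (Fin 4)`. -/
local notation "E4" => EuclideanSpace ℝ (Fin 4)

/-! ### The two branches and their common derivative -/

/-- **The toroidal coordinate map (principal branch)**
`T(y) = (arg(y₀ + iy₁), √(y₀² + y₁²) − 1, y₂, y₃) ∈ ℝ_θ × ℝ³`, smooth off the cut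
`{y₁ = 0, y₀ ≤ 0}`. [folklore] -/
def toroidalMap (y : E4) : E4 :=
  WithLp.toLp 2 ![arg (toroidalZ y), toroidalR y - 1, y 2, y 3]

/-- **The opposite branch** `T'(y) = (arg(−(y₀ + iy₁)) + π, √(y₀² + y₁²) − 1, y₂, y₃)`, smooth
off the cut `{y₁ = 0, y₀ ≥ 0}`. [folklore] -/
def toroidalMap' (y : E4) : E4 :=
  WithLp.toLp 2 ![arg (-toroidalZ y) + π, toroidalR y - 1, y 2, y 3]

/-- Components of `T`. [folklore] -/
@[simp] theorem toroidalMap_apply_zero (y : E4) : toroidalMap y 0 = arg (toroidalZ y) := rfl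
/-- Components of `T`. [folklore] -/
@[simp] theorem toroidalMap_apply_one (y : E4) : toroidalMap y 1 = toroidalR y - 1 := rfl
/-- Components of `T`. [folklore] -/
@[simp] theorem toroidalMap_apply_two (y : E4) : toroidalMap y 2 = y 2 := rfl
/-- Components of `T`. [folklore] -/
@[simp] theorem toroidalMap_apply_three (y : E4) : toroidalMap y 3 = y 3 := rfl
/-- Components of `T'`. [folklore] -/
@[simp] theorem toroidalMap'_apply_zero (y : E4) : toroidalMap' y 0 = arg (-toroidalZ y) + π := rfl
/-- Components of `T'`. [folklore] -/
@[simp] theorem toroidalMap'_apply_one (y : E4) : toroidalMap' y 1 = toroidalR y - 1 := rfl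
/-- Components of `T'`. [folklore] -/
@[simp] theorem toroidalMap'_apply_two (y : E4) : toroidalMap' y 2 = y 2 := rfl
/-- Components of `T'`. [folklore] -/
@[simp] theorem toroidalMap'_apply_three (y : E4) : toroidalMap' y 3 = y 3 := rfl

/-- The toroidal coframe `u ↦ (dt(u), da(u), u₂, u₃)` at `y` as a linear map. [folklore] -/
def toroidalDerivLin (y : E4) : E4 →ₗ[ℝ] E4 where
  toFun u := WithLp.toLp 2 ![toroidalDt y u, toroidalDa y u, u 2, u 3]
  map_add' u v := by
    ext i; fin_cases i <;> simp [toroidalDt, toroidalDa] <;> ring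
  map_smul' c u := by
    ext i; fin_cases i <;> simp [toroidalDt, toroidalDa] <;> ring

/-- **The derivative `dT_y = dT'_y`**: the continuous linear map `u ↦ (dt(u), da(u), u₂, u₃)`,
`dt(u) = (y₀u₁ − y₁u₀)/r²`, `da(u) = (y₀u₀ + y₁u₁)/r`. [folklore] -/
def toroidalDeriv (y : E4) : E4 →L[ℝ] E4 :=
  LinearMap.toContinuousLinearMap (toroidalDerivLin y)

/-- Components of `dT_y u`. [folklore] -/
@[simp] theorem toroidalDeriv_apply_zero (y u : E4) : toroidalDeriv y u 0 = toroidalDt y u := rfl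
/-- Components of `dT_y u`. [folklore] -/
@[simp] theorem toroidalDeriv_apply_one (y u : E4) : toroidalDeriv y u 1 = toroidalDa y u := rfl
/-- Components of `dT_y u`. [folklore] -/
@[simp] theorem toroidalDeriv_apply_two (y u : E4) : toroidalDeriv y u 2 = u 2 := rfl
/-- Components of `dT_y u`. [folklore] -/
@[simp] theorem toroidalDeriv_apply_three (y u : E4) : toroidalDeriv y u 3 = u 3 := rfl

/-- `d(arg ∘ z)_y = dt_y` as continuous linear maps (`Im(z⁻¹ dz) = (y₀dy₁ − y₁dy₀)/r²`).
[folklore] -/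
theorem imCLM_comp_toroidalZCLM_eq (y : E4) :
    (imCLM.comp ((toroidalZ y)⁻¹ • (1 : ℂ →L[ℝ] ℂ))).comp toroidalZCLM =
      (PiLp.proj 2 (fun _ : Fin 4 => ℝ) 0).comp (toroidalDeriv y) := by
  ext u
  change ((toroidalZ y)⁻¹ * toroidalZ u).im = toroidalDt y u
  simp only [toroidalZ, mul_im, inv_re, inv_im, normSq_apply, toroidalDt, toroidalR_sq]
  ring

/-- `d(r)_y = da_y` as continuous linear maps, off the axis. [folklore] -/
theorem hasFDerivAt_toroidalR {y : E4} (hy : 0 < toroidalR y) :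
    HasFDerivAt toroidalR ((PiLp.proj 2 (fun _ : Fin 4 => ℝ) 1).comp (toroidalDeriv y)) y := by
  have h0 : HasFDerivAt (fun x : E4 => x 0) (PiLp.proj 2 (𝕜 := ℝ) (fun _ : Fin 4 => ℝ) 0) y :=
    PiLp.hasFDerivAt_apply (𝕜 := ℝ) 2 y 0
  have h1 : HasFDerivAt (fun x : E4 => x 1) (PiLp.proj 2 (𝕜 := ℝ) (fun _ : Fin 4 => ℝ) 1) y :=
    PiLp.hasFDerivAt_apply (𝕜 := ℝ) 2 y 1
  have hf : HasFDerivAt (fun x : E4 => x 0 ^ 2 + x 1 ^ 2)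
      ((y 0 • PiLp.proj 2 (𝕜 := ℝ) (fun _ : Fin 4 => ℝ) 0 +
          y 0 • PiLp.proj 2 (𝕜 := ℝ) (fun _ : Fin 4 => ℝ) 0) +
        (y 1 • PiLp.proj 2 (𝕜 := ℝ) (fun _ : Fin 4 => ℝ) 1 +
          y 1 • PiLp.proj 2 (𝕜 := ℝ) (fun _ : Fin 4 => ℝ) 1)) y := by
    have := (h0.mul h0).add (h1.mul h1)
    refine this.congr_of_eventuallyEq (Eventually.of_forall fun x => ?_)
    simp only [Pi.add_apply, Pi.mul_apply, sq]
  have hne : y 0 ^ 2 + y 1 ^ 2 ≠ 0 := by rw [← toroidalR_sq]; positivity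
  refine (hf.sqrt hne).congr_fderiv ?_
  ext u
  have hr : toroidalR y ≠ 0 := hy.ne'
  change 1 / (2 * √(y 0 ^ 2 + y 1 ^ 2)) * (y 0 * u 0 + y 0 * u 0 + (y 1 * u 1 + y 1 * u 1)) =
    (y 0 * u 0 + y 1 * u 1) / toroidalR y
  rw [show √(y 0 ^ 2 + y 1 ^ 2) = toroidalR y from rfl]
  field_simp
  ring

/-- **`T` is differentiable off the cut `{y₁ = 0, y₀ ≤ 0}`, with derivative `dT_y`.** [folklore] -/
theorem hasFDerivAt_toroidalMap {y : E4} (hy : toroidalZ y ∈ slitPlane) :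
    HasFDerivAt toroidalMap (toroidalDeriv y) y := by
  have hr : 0 < toroidalR y := by
    rw [← norm_toroidalZ, norm_pos_iff]; exact slitPlane_ne_zero hy
  rw [← hasFDerivWithinAt_univ, hasFDerivWithinAt_euclidean]
  intro i
  rw [hasFDerivWithinAt_univ]
  fin_cases i
  · show HasFDerivAt (fun x => arg (toroidalZ x)) _ y
    exact ((hasFDerivAt_arg hy).comp y (hasFDerivAt_toroidalZ y)).congr_fderiv
      (imCLM_comp_toroidalZCLM_eq y)
  · show HasFDerivAt (fun x => toroidalR x - 1) _ y
    exact (hasFDerivAt_toroidalR hr).sub_const 1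
  · show HasFDerivAt (fun x : E4 => x 2) _ y
    exact (PiLp.hasFDerivAt_apply (𝕜 := ℝ) 2 y 2).congr_fderiv
      (ContinuousLinearMap.ext fun u => rfl)
  · show HasFDerivAt (fun x : E4 => x 3) _ y
    exact (PiLp.hasFDerivAt_apply (𝕜 := ℝ) 2 y 3).congr_fderiv
      (ContinuousLinearMap.ext fun u => rfl)

/-- **`T'` is differentiable off the cut `{y₁ = 0, y₀ ≥ 0}`, with the same derivative `dT_y`.**
[folklore] -/
theorem hasFDerivAt_toroidalMap' {y : E4} (hy : -toroidalZ y ∈ slitPlane) :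
    HasFDerivAt toroidalMap' (toroidalDeriv y) y := by
  have hr : 0 < toroidalR y := by
    rw [← norm_toroidalZ, norm_pos_iff, ← neg_ne_zero]; exact slitPlane_ne_zero hy
  rw [← hasFDerivWithinAt_univ, hasFDerivWithinAt_euclidean]
  intro i
  rw [hasFDerivWithinAt_univ]
  fin_cases i
  · show HasFDerivAt (fun x => arg (-toroidalZ x) + π) _ y
    exact ((hasFDerivAt_arg_neg_add_pi hy).comp y (hasFDerivAt_toroidalZ y)).congr_fderiv
      (imCLM_comp_toroidalZCLM_eq y)
  · show HasFDerivAt (fun x => toroidalR x - 1) _ y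
    exact (hasFDerivAt_toroidalR hr).sub_const 1
  · show HasFDerivAt (fun x : E4 => x 2) _ y
    exact (PiLp.hasFDerivAt_apply (𝕜 := ℝ) 2 y 2).congr_fderiv
      (ContinuousLinearMap.ext fun u => rfl)
  · show HasFDerivAt (fun x : E4 => x 3) _ y
    exact (PiLp.hasFDerivAt_apply (𝕜 := ℝ) 2 y 3).congr_fderiv
      (ContinuousLinearMap.ext fun u => rfl)

/-- `r` is smooth off the axis. [folklore] -/
theorem contDiffAt_toroidalR {y : E4} (hy : 0 < toroidalR y) : ContDiffAt ℝ ∞ toroidalR y := by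
  have hne : y 0 ^ 2 + y 1 ^ 2 ≠ 0 := by rw [← toroidalR_sq]; positivity
  have hf : ContDiffAt ℝ ∞ (fun x : E4 => x 0 ^ 2 + x 1 ^ 2) y := by fun_prop
  exact hf.sqrt hne

/-- **`T` is smooth off its cut.** [folklore] -/
theorem contDiffAt_toroidalMap {y : E4} (hy : toroidalZ y ∈ slitPlane) :
    ContDiffAt ℝ ∞ toroidalMap y := by
  have hr : 0 < toroidalR y := by
    rw [← norm_toroidalZ, norm_pos_iff]; exact slitPlane_ne_zero hy
  rw [contDiffAt_euclidean]
  intro i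
  fin_cases i
  · show ContDiffAt ℝ ∞ (fun x => arg (toroidalZ x)) y
    exact (contDiffAt_arg hy).comp y contDiff_toroidalZ.contDiffAt
  · show ContDiffAt ℝ ∞ (fun x => toroidalR x - 1) y
    exact (contDiffAt_toroidalR hr).sub contDiffAt_const
  · show ContDiffAt ℝ ∞ (fun x : E4 => x 2) y
    fun_prop
  · show ContDiffAt ℝ ∞ (fun x : E4 => x 3) y
    fun_prop

/-- **`T'` is smooth off its cut.** [folklore] -/
theorem contDiffAt_toroidalMap' {y : E4} (hy : -toroidalZ y ∈ slitPlane) :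
    ContDiffAt ℝ ∞ toroidalMap' y := by
  have hr : 0 < toroidalR y := by
    rw [← norm_toroidalZ, norm_pos_iff, ← neg_ne_zero]; exact slitPlane_ne_zero hy
  rw [contDiffAt_euclidean]
  intro i
  fin_cases i
  · show ContDiffAt ℝ ∞ (fun x => arg (-toroidalZ x) + π) y
    exact (contDiffAt_arg_neg_add_pi hy).comp y contDiff_toroidalZ.contDiffAt
  · show ContDiffAt ℝ ∞ (fun x => toroidalR x - 1) y
    exact (contDiffAt_toroidalR hr).sub contDiffAt_const
  · show ContDiffAt ℝ ∞ (fun x : E4 => x 2) y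
    fun_prop
  · show ContDiffAt ℝ ∞ (fun x : E4 => x 3) y
    fun_prop

/-! ### The branch relation, injectivity, and the images of the tube and the core -/

/-- **The branch relation** `T'(y) = T(y) + 2πk · e_θ` for some `k ∈ ℤ`, off the axis
(Mathlib's `arg (-x) = arg x + π` in `ℝ/2πℤ`). [folklore] -/
theorem toroidalMap'_eq_toroidalMap_add {y : E4} (hy : 0 < toroidalR y) :
    ∃ k : ℤ, toroidalMap' y = toroidalMap y + (2 * π * k) • EuclideanSpace.single 0 1 := by
  have hz := toroidalZ_ne_zero hy
  have hang : ((arg (-toroidalZ y) + π : ℝ) : Real.Angle) = (arg (toroidalZ y) : Real.Angle) := by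
    rw [Real.Angle.coe_add, arg_neg_coe_angle hz, add_assoc, ← Real.Angle.coe_add,
      ← two_mul, Real.Angle.coe_two_pi, add_zero]
  obtain ⟨k, hk⟩ := Real.Angle.angle_eq_iff_two_pi_dvd_sub.1 hang
  refine ⟨k, euclidean_four_ext ?_ ?_ ?_ ?_⟩
  · simp only [toroidalMap'_apply_zero, PiLp.add_apply, toroidalMap_apply_zero, PiLp.smul_apply,
      PiLp.single_apply, if_true, smul_eq_mul, mul_one]
    linarith
  · simp
  · simp
  · simp

/-- **`dT_y` is injective off the axis** (hence a linear isomorphism of `ℝ⁴`). [folklore] -/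
theorem toroidalDeriv_injective {y : E4} (hy : 0 < toroidalR y) :
    Function.Injective (toroidalDeriv y) := by
  refine (injective_iff_map_eq_zero (toroidalDeriv y)).2 fun u hu => ?_
  have h0 : toroidalDt y u = 0 := by simpa using congrArg (fun w : E4 => w 0) hu
  have h1 : toroidalDa y u = 0 := by simpa using congrArg (fun w : E4 => w 1) hu
  have h2 : u 2 = 0 := by simpa using congrArg (fun w : E4 => w 2) hu
  have h3 : u 3 = 0 := by simpa using congrArg (fun w : E4 => w 3) hu
  simp only [toroidalDt, toroidalDa] at h0 h1
  have hr : toroidalR y ≠ 0 := hy.ne'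
  have hr2 : toroidalR y ^ 2 ≠ 0 := pow_ne_zero 2 hr
  rw [div_eq_zero_iff, or_iff_left hr2] at h0
  rw [div_eq_zero_iff, or_iff_left hr] at h1
  have hsq := toroidalR_sq y
  have hpos : 0 < y 0 ^ 2 + y 1 ^ 2 := by rw [← hsq]; positivity
  have hu0 : (y 0 ^ 2 + y 1 ^ 2) * u 0 = 0 := by linear_combination y 0 * h1 - y 1 * h0
  have hu1 : (y 0 ^ 2 + y 1 ^ 2) * u 1 = 0 := by linear_combination y 1 * h1 + y 0 * h0
  have e0 : u 0 = 0 := by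
    rcases mul_eq_zero.1 hu0 with h | h
    · exact absurd h hpos.ne'
    · exact h
  have e1 : u 1 = 0 := by
    rcases mul_eq_zero.1 hu1 with h | h
    · exact absurd h hpos.ne'
    · exact h
  exact euclidean_four_ext e0 e1 h2 h3

/-- `dT_y` is surjective off the axis. [folklore] -/
theorem toroidalDeriv_surjective {y : E4} (hy : 0 < toroidalR y) :
    Function.Surjective (toroidalDeriv y) :=
  (LinearMap.injective_iff_surjective (f := (toroidalDeriv y : E4 →ₗ[ℝ] E4))).1
    (toroidalDeriv_injective hy)

/-- **`T` is injective modulo `2πℤ · e_θ`** (polar coordinates: a complex number is determined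
by modulus and principal argument). [folklore] -/
theorem eq_of_toroidalMap_eq_add {y y' : E4} {k : ℤ}
    (h : toroidalMap y' = toroidalMap y + (2 * π * k) • EuclideanSpace.single 0 1) :
    y' = y := by
  have h0 : arg (toroidalZ y') = arg (toroidalZ y) + 2 * π * k := by
    simpa using congrArg (fun w : E4 => w 0) h
  have h1 : toroidalR y' = toroidalR y := by simpa using congrArg (fun w : E4 => w 1) h
  have h2 : y' 2 = y 2 := by simpa using congrArg (fun w : E4 => w 2) h
  have h3 : y' 3 = y 3 := by simpa using congrArg (fun w : E4 => w 3) h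
  -- the integer `k` vanishes since both arguments lie in `(-π, π]`
  have hk : (k : ℝ) = 0 := by
    have ha := arg_mem_Ioc (toroidalZ y)
    have ha' := arg_mem_Ioc (toroidalZ y')
    have hlo : -(2 * π) < 2 * π * k := by linarith [ha.1, ha.2, ha'.1, ha'.2]
    have hhi : 2 * π * k < 2 * π := by linarith [ha.1, ha.2, ha'.1, ha'.2]
    have hk1 : (k : ℝ) < 1 := by
      by_contra hc
      have hc' : (1 : ℝ) ≤ k := not_lt.1 hc
      nlinarith [Real.pi_pos]
    have hk2 : (-1 : ℝ) < k := by
      by_contra hc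
      have hc' : (k : ℝ) ≤ -1 := not_lt.1 hc
      nlinarith [Real.pi_pos]
    have i1 : k < 1 := by exact_mod_cast hk1
    have i2 : -1 < k := by exact_mod_cast hk2
    have : k = 0 := by omega
    simp [this]
  rw [hk, mul_zero, add_zero] at h0
  have hz : toroidalZ y' = toroidalZ y := by
    refine ext_norm_arg ?_ h0
    rw [norm_toroidalZ, norm_toroidalZ]; linarith
  have e0 : y' 0 = y 0 := congrArg re hz
  have e1 : y' 1 = y 1 := congrArg im hz
  exact euclidean_four_ext e0 e1 h2 h3

/-- **`T` maps the flat solid torus `U_δ` into the model tube `ℝ × B³(δ)`.** [folklore] -/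
theorem toroidalMap_mem_hondaTube {δ : ℝ} {y : E4} (hy : y ∈ flatSolidTorus δ) :
    toroidalMap y ∈ hondaTube δ := by
  rw [mem_flatSolidTorus] at hy
  simpa [mem_hondaTube] using hy

/-- `T'` maps the flat solid torus `U_δ` into the model tube `ℝ × B³(δ)`. [folklore] -/
theorem toroidalMap'_mem_hondaTube {δ : ℝ} {y : E4} (hy : y ∈ flatSolidTorus δ) :
    toroidalMap' y ∈ hondaTube δ := by
  rw [mem_flatSolidTorus] at hy
  simpa [mem_hondaTube] using hy

/-- **`T` maps the core circle `C₀` into the axis.** [folklore] -/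
theorem toroidalMap_mem_hondaAxis {y : E4} (hy : y ∈ flatCoreCircle) :
    toroidalMap y ∈ hondaAxis := by
  rcases hy with ⟨h01, h2, h3⟩
  have : toroidalR y = 1 := by simp [toroidalR, h01]
  simp [mem_hondaAxis, this, h2, h3]

/-- Off the core circle (inside a region missing the axis) `T` lands off the axis. [folklore] -/
theorem toroidalMap_not_mem_hondaAxis {y : E4} (hy : y ∉ flatCoreCircle) :
    toroidalMap y ∉ hondaAxis := by
  intro h
  apply hy
  rw [mem_hondaAxis] at h
  simp only [toroidalMap_apply_one, toroidalMap_apply_two, toroidalMap_apply_three,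
    sub_eq_zero] at h
  refine ⟨?_, h.2.1, h.2.2⟩
  have := toroidalR_sq y
  rw [h.1, one_pow] at this
  exact this.symm

/-- **Every point of the axis is `T(y) + 2πk · e_θ` for a point `y` of the core circle**
(`y = (cos θ, sin θ, 0, 0)`, `arg` of a unit complex number is its angle modulo `2π`). [folklore] -/
theorem exists_toroidalMap_eq_of_mem_hondaAxis {q : E4} (hq : q ∈ hondaAxis) :
    ∃ y ∈ flatCoreCircle, ∃ k : ℤ,
      q = toroidalMap y + (2 * π * k) • EuclideanSpace.single 0 1 := by
  rcases hq with ⟨h1, h2, h3⟩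
  set θ : ℝ := q 0 with hθ
  refine ⟨WithLp.toLp 2 ![Real.cos θ, Real.sin θ, 0, 0], ?_, -⌊(π - θ) / (2 * π)⌋, ?_⟩
  · refine ⟨?_, by simp, by simp⟩
    simp [Real.cos_sq_add_sin_sq]
  · have hzc : toroidalZ (WithLp.toLp 2 ![Real.cos θ, Real.sin θ, 0, 0]) =
        Complex.cos θ + Complex.sin θ * I := by
      apply Complex.ext <;>
        simp [toroidalZ, Complex.cos_ofReal_re, Complex.sin_ofReal_re, Complex.cos_ofReal_im,
          Complex.sin_ofReal_im]
    have harg : arg (toroidalZ (WithLp.toLp 2 ![Real.cos θ, Real.sin θ, 0, 0])) =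
        θ + 2 * π * ⌊(π - θ) / (2 * π)⌋ := by
      rw [hzc]
      have := arg_cos_add_sin_mul_I_sub θ
      linarith
    have hR : toroidalR (WithLp.toLp 2 ![Real.cos θ, Real.sin θ, 0, 0]) = 1 := by
      simp [toroidalR, Real.cos_sq_add_sin_sq]
    refine euclidean_four_ext ?_ ?_ ?_ ?_
    · simp only [PiLp.add_apply, toroidalMap_apply_zero, harg, PiLp.smul_apply,
        PiLp.single_apply, if_true, smul_eq_mul, mul_one]
      push_cast; ring
    · simp [hR, h1]
    · simp [h2]
    · simp [h3]

end Literature.Geometry.Symplectic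

end
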